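/-
Copyright (c) 2026 the pub-hodgecm-mathlib formalisation cell (harness21).  Prover seat hodgecm-mathlib-K2E3-p03 (g8), HCML Track B «K2-LIT» ∕ h413
(`stmt-HodgeConjecture-24833`), leaf (nsc-S-A′), case bricks C1″∕C1′ (`sig_K2E3GL3SAprimeC1high` ∕ `…C1low`): the (T)-programme F4′∕F5 — IRREDUCIBILITY OF THE
`P₁₂`-STANDARD MODULE `D‴` AND OF THE LOW STANDARD MODULE `D_low` FROM THAT OF `D″` (pigeonhole + transport; no second «Kill»).  2026-09-04.
-/
import Summits.HodgeConjecture.HodgeConjecture.Theorems.K2E3GL3OneLinkNestedHighIdentification   -- ★ FILE 3a (this seat): `nonempty_equiv_D_of_weight_X`; brings ★ FILE 1, ★ IRR″-a∕-b, ADD, EMB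
import Summits.HodgeConjecture.HodgeConjecture.Theorems.K2E3GL3OneLinkNestedHighPrimeSplit       -- ★ F2∕F3 (this lineage, g7): `exists_piece_X_two'`, `finrank_weightSpace_D'_high`, `isSmooth_D'_high`; brings ★ F1 IRR-T
import Summits.HodgeConjecture.HodgeConjecture.Theorems.K2E3GL3OneLinkNestedHighConstituent      -- ★ IRR″-b2 (K2E3-p17): `exists_constituent_X_two`
import HarnessLib

/-!
# Crux `H413` — leaf (nsc-S-A′), bricks C1″∕C1′: `D‴` and `D_low` are irreducible as soon as `D″` is (F4′∕F5 of the (T)-programme)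

Cell `hodgecm-mathlib`, Track B; THEOREMS ONLY; count-neutral helper (`--supports stmt-HodgeConjecture-24833 --as helper`).  Letters of ★ IRR″-a (K2E3-p17):
`a = ην½⁻¹`, `aν = ην½`, `X = tch(a,aν,aν)`, `Y = tch(aν,a,aν)`; `D″(η) = D(η, ην½) = Ind_{P₂₁}(η∘det₂ ⊠ ην½) ↪ I(X)` (★ STD-EMB), `D‴(η) = D′(ην½, η) =
Ind_{P₁₂}(ην½ ⊠ η∘det₂) ↪ I(Y)` (★ STD-EMB′), both with `E = {X², Y}` (★ IRR″-a ∕ ★ F2∕F3); `D_low(η) = D(η, ην½⁻¹) = Ind_{P₂₁}(η∘det₂ ⊠ ην½⁻¹)` (the C1′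
standard module, support `{a, aν, a}`).
* §1 **F4′ `isIrreducible_D'_high_of`: `D″(η)` irreducible ⇒ `D‴(η)` irreducible.**  A proper non-zero `N ≤ D‴` has an `{X²}`-piece (★ F2∕F3 `exists_piece_X_two'`), hence an
  irreducible constituent `ω` with `E(ω) = {X²}` (★ IRR″-b2 `exists_constituent_X_two`); but an irreducible with an `X`-weight is `≅ D″` (★ FILE 3a
  `nonempty_equiv_D_of_weight_X`, UNIQ-PIGEONHOLE (b): `mult (I X) X ≤ 2 < 2 + 2`), and `mult D″ Y = 1 ≠ 0 = mult ω Y` ✗.  No «Kill‴» is needed.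
* §2 **F5 `isIrreducible_D_low_of` ∕ `isIrreducible_D_low_of_isIrreducible_D_high`: `D‴(η⁻¹)` irreducible ⇒ `D_low(η)` irreducible** (★ F1 IRR-T `isIrreducible_D'_iff` at
  `(x, y) = ((ην½⁻¹)⁻¹, η⁻¹)` and the letter identity `(ην½⁻¹)⁻¹ = η⁻¹ν½`), hence **`D″(η⁻¹)` irreducible ⇒ `D_low(η)` irreducible**.
So IRR″ (K2E3-p17 (g9), ★-pending) is the only irreducibility input of BOTH C1″ (`hIRR` of ★ `K2E3GL3OneLinkNestedHigh.sAprimeC1high_of`, NYA via `D‴`) and C1′ (IRR_low).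
[BernsteinZelevinsky1977, §2.3, Cor. 2.13, Thm. 2.9]; [Zelevinsky1980, §1.1, §1.6, Prop. 2.10, Ex. 3.2, Thm. 6.1].

HONEST LABEL: HC_CM is proved only modulo the 7 printed citations (2 remaining named inputs: hLiu418 = stmt-HodgeConjecture-24832, h413 =
stmt-HodgeConjecture-24833) until rung 0 closes; count-neutral helper, CONDITIONAL on the binder `hIRR` (IRR″ for `D″`) and the cell binder `h3cell` for `I(Y)` (★ (CELL-3)
discharges it at use), stated not assumed.

## References
* [BernsteinZelevinsky1977] I. N. Bernstein, A. V. Zelevinsky, *Induced representations of reductive p-adic groups I*, Ann. Sci. ÉNS 10 (1977), §2.3, Cor. 2.13, Thm. 2.9.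
* [Zelevinsky1980] A. V. Zelevinsky, *Induced representations of reductive p-adic groups II*, Ann. Sci. ÉNS 13 (1980), §1.1, §1.6, Prop. 2.10, Ex. 3.2, Thm. 6.1.
* [Casselman1995] W. Casselman, *Introduction to the theory of admissible representations of p-adic reductive groups* (1995), §6.3.
-/

set_option autoImplicit false
-- the mandated namespace repeats `HodgeConjecture.HodgeConjecture`, as in every `Theorems/*.lean` of this sub-problem
set_option linter.dupNamespace false

noncomputable section

open Module Representation Function Literature.NumberTheory.Automorphic Literature.NumberTheory.Automorphic.Zelevinsky1980 Literature.NumberTheory.GaloisRepresentations.IsNonarchimedeanLocalField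
open Literature.NumberTheory.GaloisRepresentations Literature.RepresentationTheory.FiniteGroups
open scoped MatrixGroups NNReal
open Summit.HodgeConjecture.HodgeConjecture.Cruxes.H413.K2E3GL3OneLinkNestedHighPieces (finrank_weightSpace_D_high tch_X_ne_Y isOpen_ker_b)
open Summit.HodgeConjecture.HodgeConjecture.Cruxes.H413.K2E3GL3OneLinkNestedHighPrimeSplit (finrank_weightSpace_D'_high isSmooth_D'_high nontrivial_coinvariants_of_isConstituentOf_D'_high
  exists_piece_X_two')
open Summit.HodgeConjecture.HodgeConjecture.Cruxes.H413.K2E3GL3OneLinkNestedHighConstituent (exists_constituent_X_two)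
open Summit.HodgeConjecture.HodgeConjecture.Cruxes.H413.K2E3GL3JacquetMultiplicityAdditive (finrank_weightSpace_eq_of_equiv)
open Summit.HodgeConjecture.HodgeConjecture.Cruxes.H413.K2E3GL3ExponentClassTools (nontrivial_of_finrank_weightSpace_ne_zero bot_ne_top_subrepresentation)
open Summit.HodgeConjecture.HodgeConjecture.Cruxes.H413.K2E3GL3StandardModuleEmbedding (ker_inv_eq_ker)
open Summit.HodgeConjecture.HodgeConjecture.Cruxes.H413.K2E3GL3BorelInducedTransport (isIrreducible_D'_iff)
open Summit.HodgeConjecture.HodgeConjecture.Cruxes.H413.K2E3GL3OneLinkNestedHighIdentification (nonempty_equiv_D_of_weight_X)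

namespace Summit.HodgeConjecture.HodgeConjecture.Cruxes.H413.K2E3GL3OneLinkNestedHighIrreduciblePrime

variable {F : Type} [Field F] [ValuativeRel F] [TopologicalSpace F] [IsNonarchimedeanLocalField F] (η : Fˣ →* ℂˣ)

/-! ## §1 F4′: `D‴` is irreducible as soon as `D″` is -/

set_option maxHeartbeats 800000 in  -- large weight terms: cumulative elaboration budget (as in ★ FILE 1)
/-- **No irreducible `ω` with `E(ω) = {X²}` once `D″` is irreducible**: an `X`-weight makes `ω ≅ D″` (★ FILE 3a `nonempty_equiv_D_of_weight_X`), and `mult D″ Y = 1`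
(★ IRR″-a) while `mult ω Y = 0`. [cite: BernsteinZelevinsky1977, Cor. 2.13, Thm. 2.9] [cite: Zelevinsky1980, Ex. 3.2, Thm. 6.1] -/
theorem false_of_weights_X_two (hη : IsOpen ((η.ker : Subgroup Fˣ) : Set Fˣ)) (hIRR : ((Representation.parabolicIndGL F (![false, false, true] : Fin 3 → Bool) ((Representation.trivial ℂ (Π a : Bool, GL {i : Fin 3 // (![false, false, true] : Fin 3 → Bool) i = a} F) ℂ).twist ((η.comp (Matrix.GeneralLinearGroup.det.comp (Pi.evalMonoidHom (fun a : Bool => GL {i : Fin 3 // (![false, false, true] : Fin 3 → Bool) i = a} F) false))) * ((η * ((unramifiedTwist F (1 / 2) : QuasiChar F).toMonoidHom)).comp (Matrix.GeneralLinearGroup.det.comp (Pi.evalMonoidHom (fun a : Bool => GL {i : Fin 3 // (![false, false, true] : Fin 3 → Bool) i = a} F) true))))))).IsIrreducible) (r : SmoothIrrep (GL (Fin 3) F)) [FiniteDimensional ℂ (restrictUnipotentGL F (id : Fin 3 → Fin 3) r.ρ).Coinvariants]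
    (hX : finrank ℂ ↥(⨅ m, Module.End.maxGenEigenspace (Representation.normalizedJacquetGL F (id : Fin 3 → Fin 3) r.ρ m) (((∏ a : Fin 3, ((![(η * ((unramifiedTwist F (1 / 2) : QuasiChar F).toMonoidHom)⁻¹), (η * ((unramifiedTwist F (1 / 2) : QuasiChar F).toMonoidHom)), (η * ((unramifiedTwist F (1 / 2) : QuasiChar F).toMonoidHom))] : Fin 3 → (Fˣ →* ℂˣ)) a).comp (Matrix.GeneralLinearGroup.det.comp (Pi.evalMonoidHom (fun a : Fin 3 => GL {i : Fin 3 // (id : Fin 3 → Fin 3) i = a} F) a))) m : ℂˣ) : ℂ)) = 2)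
    (h0 : ∀ ζ : (Π a : Fin 3, GL {i : Fin 3 // (id : Fin 3 → Fin 3) i = a} F) → ℂ, ζ ≠ (fun m : (Π a : Fin 3, GL {i : Fin 3 // (id : Fin 3 → Fin 3) i = a} F) => (((∏ a : Fin 3, ((![(η * ((unramifiedTwist F (1 / 2) : QuasiChar F).toMonoidHom)⁻¹), (η * ((unramifiedTwist F (1 / 2) : QuasiChar F).toMonoidHom)), (η * ((unramifiedTwist F (1 / 2) : QuasiChar F).toMonoidHom))] : Fin 3 → (Fˣ →* ℂˣ)) a).comp (Matrix.GeneralLinearGroup.det.comp (Pi.evalMonoidHom (fun a : Fin 3 => GL {i : Fin 3 // (id : Fin 3 → Fin 3) i = a} F) a))) m : ℂˣ) : ℂ)) → finrank ℂ ↥(⨅ m, Module.End.maxGenEigenspace (Representation.normalizedJacquetGL F (id : Fin 3 → Fin 3) r.ρ m) (ζ m)) = 0) : False := by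
  haveI : r.ρ.IsIrreducible := r.isIrreducible
  have he := nonempty_equiv_D_of_weight_X η r.ρ hη hIRR r.isSmooth (by omega)
  have hY := h0 (fun m : (Π a : Fin 3, GL {i : Fin 3 // (id : Fin 3 → Fin 3) i = a} F) => (((∏ a : Fin 3, ((![(η * ((unramifiedTwist F (1 / 2) : QuasiChar F).toMonoidHom)), (η * ((unramifiedTwist F (1 / 2) : QuasiChar F).toMonoidHom)⁻¹), (η * ((unramifiedTwist F (1 / 2) : QuasiChar F).toMonoidHom))] : Fin 3 → (Fˣ →* ℂˣ)) a).comp (Matrix.GeneralLinearGroup.det.comp (Pi.evalMonoidHom (fun a : Fin 3 => GL {i : Fin 3 // (id : Fin 3 → Fin 3) i = a} F) a))) m : ℂˣ) : ℂ)) (Ne.symm (tch_X_ne_Y η))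
  have hD := (finrank_weightSpace_D_high η hη (fun m : (Π a : Fin 3, GL {i : Fin 3 // (id : Fin 3 → Fin 3) i = a} F) => (((∏ a : Fin 3, ((![(η * ((unramifiedTwist F (1 / 2) : QuasiChar F).toMonoidHom)), (η * ((unramifiedTwist F (1 / 2) : QuasiChar F).toMonoidHom)⁻¹), (η * ((unramifiedTwist F (1 / 2) : QuasiChar F).toMonoidHom))] : Fin 3 → (Fˣ →* ℂˣ)) a).comp (Matrix.GeneralLinearGroup.det.comp (Pi.evalMonoidHom (fun a : Fin 3 => GL {i : Fin 3 // (id : Fin 3 → Fin 3) i = a} F) a))) m : ℂˣ) : ℂ))).2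
  beta_reduce at hY hD
  rw [if_neg (Ne.symm (tch_X_ne_Y η)), if_pos rfl, ← finrank_weightSpace_eq_of_equiv _ _ he.some (fun m : (Π a : Fin 3, GL {i : Fin 3 // (id : Fin 3 → Fin 3) i = a} F) => (((∏ a : Fin 3, ((![(η * ((unramifiedTwist F (1 / 2) : QuasiChar F).toMonoidHom)), (η * ((unramifiedTwist F (1 / 2) : QuasiChar F).toMonoidHom)⁻¹), (η * ((unramifiedTwist F (1 / 2) : QuasiChar F).toMonoidHom))] : Fin 3 → (Fˣ →* ℂˣ)) a).comp (Matrix.GeneralLinearGroup.det.comp (Pi.evalMonoidHom (fun a : Fin 3 => GL {i : Fin 3 // (id : Fin 3 → Fin 3) i = a} F) a))) m : ℂˣ) : ℂ))] at hD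
  omega

set_option maxHeartbeats 1600000 in  -- two pieces × the bookkeeping of ★ F2∕F3 and ★ IRR″-b2 (cumulative budget)
/-- **F4′ — `D″(η)` IRREDUCIBLE ⇒ `D‴(η) = Ind_{P₁₂}(ην½ ⊠ η∘det₂)` IRREDUCIBLE.**  A proper non-zero `N ≤ D‴` yields a piece `P ∈ {N, D‴⁄N}` with `E(P) = {X²}` (★ F2∕F3
`exists_piece_X_two'`), an irreducible constituent `ω` of `P` with `E(ω) = {X²}` (★ IRR″-b2 `exists_constituent_X_two`; constituents of `D‴` have `r_B ≠ 0` under the cell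
binder `h3cell` for `I(Y)`, ★ F2∕F3), and `false_of_weights_X_two`. [cite: BernsteinZelevinsky1977, §2.3, Cor. 2.13, Thm. 2.9] [cite: Zelevinsky1980, §1.6, Ex. 3.2, Thm. 6.1] -/
theorem isIrreducible_D'_high_of (hη : IsOpen ((η.ker : Subgroup Fˣ) : Set Fˣ)) (hIRR : ((Representation.parabolicIndGL F (![false, false, true] : Fin 3 → Bool) ((Representation.trivial ℂ (Π a : Bool, GL {i : Fin 3 // (![false, false, true] : Fin 3 → Bool) i = a} F) ℂ).twist ((η.comp (Matrix.GeneralLinearGroup.det.comp (Pi.evalMonoidHom (fun a : Bool => GL {i : Fin 3 // (![false, false, true] : Fin 3 → Bool) i = a} F) false))) * ((η * ((unramifiedTwist F (1 / 2) : QuasiChar F).toMonoidHom)).comp (Matrix.GeneralLinearGroup.det.comp (Pi.evalMonoidHom (fun a : Bool => GL {i : Fin 3 // (![false, false, true] : Fin 3 → Bool) i = a} F) true))))))).IsIrreducible)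
    (h3cell : ∀ c : Fin 3 → Fin 2, Monotone c → Function.Surjective c →
      ∀ (W : Type) [AddCommGroup W] [Module ℂ W] (σ : Representation ℂ (Π a : Fin 2, GL {i : Fin 3 // c i = a} F) W),
        σ.IsIrreducible → σ.IsSmooth → σ.IsSupercuspidal →
        ∀ (N : Subrepresentation (jacquetGL F c (Representation.parabolicIndGL F (id : Fin 3 → Fin 3) ((Representation.trivial ℂ (Π a : Fin 3, GL {i : Fin 3 // (id : Fin 3 → Fin 3) i = a} F) ℂ).twist (∏ a : Fin 3, ((![(η * ((unramifiedTwist F (1 / 2) : QuasiChar F).toMonoidHom)), (η * ((unramifiedTwist F (1 / 2) : QuasiChar F).toMonoidHom)⁻¹), (η * ((unramifiedTwist F (1 / 2) : QuasiChar F).toMonoidHom))] : Fin 3 → (Fˣ →* ℂˣ)) a).comp (Matrix.GeneralLinearGroup.det.comp (Pi.evalMonoidHom (fun a : Fin 3 => GL {i : Fin 3 // (id : Fin 3 → Fin 3) i = a} F) a)))))))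
          (q : N.toRepresentation.IntertwiningMap σ), q = 0) :
    ((Representation.parabolicIndGL F (![false, true, true] : Fin 3 → Bool) ((Representation.trivial ℂ (Π a : Bool, GL {i : Fin 3 // (![false, true, true] : Fin 3 → Bool) i = a} F) ℂ).twist (((η * ((unramifiedTwist F (1 / 2) : QuasiChar F).toMonoidHom)).comp (Matrix.GeneralLinearGroup.det.comp (Pi.evalMonoidHom (fun a : Bool => GL {i : Fin 3 // (![false, true, true] : Fin 3 → Bool) i = a} F) false))) * (η.comp (Matrix.GeneralLinearGroup.det.comp (Pi.evalMonoidHom (fun a : Bool => GL {i : Fin 3 // (![false, true, true] : Fin 3 → Bool) i = a} F) true))))))).IsIrreducible := by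
  have hD := isSmooth_D'_high η
  haveI hfd : FiniteDimensional ℂ (restrictUnipotentGL F (id : Fin 3 → Fin 3) (Representation.parabolicIndGL F (![false, true, true] : Fin 3 → Bool) ((Representation.trivial ℂ (Π a : Bool, GL {i : Fin 3 // (![false, true, true] : Fin 3 → Bool) i = a} F) ℂ).twist (((η * ((unramifiedTwist F (1 / 2) : QuasiChar F).toMonoidHom)).comp (Matrix.GeneralLinearGroup.det.comp (Pi.evalMonoidHom (fun a : Bool => GL {i : Fin 3 // (![false, true, true] : Fin 3 → Bool) i = a} F) false))) * (η.comp (Matrix.GeneralLinearGroup.det.comp (Pi.evalMonoidHom (fun a : Bool => GL {i : Fin 3 // (![false, true, true] : Fin 3 → Bool) i = a} F) true))))))).Coinvariants := (finrank_weightSpace_D'_high η hη (fun m : (Π a : Fin 3, GL {i : Fin 3 // (id : Fin 3 → Fin 3) i = a} F) => (((∏ a : Fin 3, ((![(η * ((unramifiedTwist F (1 / 2) : QuasiChar F).toMonoidHom)⁻¹), (η * ((unramifiedTwist F (1 / 2) : QuasiChar F).toMonoidHom)), (η * ((unramifiedTwist F (1 / 2) : QuasiChar F).toMonoidHom))] :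 Fin 3 → (Fˣ →* ℂˣ)) a).comp (Matrix.GeneralLinearGroup.det.comp (Pi.evalMonoidHom (fun a : Fin 3 => GL {i : Fin 3 // (id : Fin 3 → Fin 3) i = a} F) a))) m : ℂˣ) : ℂ))).1
  have hXval := (finrank_weightSpace_D'_high η hη (fun m : (Π a : Fin 3, GL {i : Fin 3 // (id : Fin 3 → Fin 3) i = a} F) => (((∏ a : Fin 3, ((![(η * ((unramifiedTwist F (1 / 2) : QuasiChar F).toMonoidHom)⁻¹), (η * ((unramifiedTwist F (1 / 2) : QuasiChar F).toMonoidHom)), (η * ((unramifiedTwist F (1 / 2) : QuasiChar F).toMonoidHom))] : Fin 3 → (Fˣ →* ℂˣ)) a).comp (Matrix.GeneralLinearGroup.det.comp (Pi.evalMonoidHom (fun a : Fin 3 => GL {i : Fin 3 // (id : Fin 3 → Fin 3) i = a} F) a))) m : ℂˣ) : ℂ))).2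
  beta_reduce at hXval
  rw [if_pos rfl, if_neg (tch_X_ne_Y η)] at hXval
  have hX0 : finrank ℂ ↥(⨅ m, Module.End.maxGenEigenspace (Representation.normalizedJacquetGL F (id : Fin 3 → Fin 3) (Representation.parabolicIndGL F (![false, true, true] : Fin 3 → Bool) ((Representation.trivial ℂ (Π a : Bool, GL {i : Fin 3 // (![false, true, true] : Fin 3 → Bool) i = a} F) ℂ).twist (((η * ((unramifiedTwist F (1 / 2) : QuasiChar F).toMonoidHom)).comp (Matrix.GeneralLinearGroup.det.comp (Pi.evalMonoidHom (fun a : Bool => GL {i : Fin 3 // (![false, true, true] : Fin 3 → Bool) i = a} F) false))) * (η.comp (Matrix.GeneralLinearGroup.det.comp (Pi.evalMonoidHom (fun a : Bool => GL {i : Fin 3 // (![false, true, true] : Fin 3 → Bool) i = a} F) true)))))) m) (((∏ a : Fin 3, ((![(η * ((unramifiedTwist F (1 / 2) : QuasiChar F).toMonoidHom)⁻¹), (η * ((unramifiedTwist F (1 / 2) : QuasiChar F).toMonoidHom)), (η * ((unramifiedTwist F (1 / 2) : QuasiChar F).toMonoidHom))] : Fin 3 → (Fˣ →* ℂˣ))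 a).comp (Matrix.GeneralLinearGroup.det.comp (Pi.evalMonoidHom (fun a : Fin 3 => GL {i : Fin 3 // (id : Fin 3 → Fin 3) i = a} F) a))) m : ℂˣ) : ℂ)) ≠ 0 := by omega
  haveI := nontrivial_of_finrank_weightSpace_ne_zero (Representation.parabolicIndGL F (![false, true, true] : Fin 3 → Bool) ((Representation.trivial ℂ (Π a : Bool, GL {i : Fin 3 // (![false, true, true] : Fin 3 → Bool) i = a} F) ℂ).twist (((η * ((unramifiedTwist F (1 / 2) : QuasiChar F).toMonoidHom)).comp (Matrix.GeneralLinearGroup.det.comp (Pi.evalMonoidHom (fun a : Bool => GL {i : Fin 3 // (![false, true, true] : Fin 3 → Bool) i = a} F) false))) * (η.comp (Matrix.GeneralLinearGroup.det.comp (Pi.evalMonoidHom (fun a : Bool => GL {i : Fin 3 // (![false, true, true] : Fin 3 → Bool) i = a} F) true)))))) (fun m : (Π a : Fin 3, GL {i : Fin 3 // (id : Fin 3 → Fin 3) i = a} F) => (((∏ a : Fin 3, ((![(η * ((unramifiedTwist F (1 / 2) : QuasiChar F).toMonoidHom)⁻¹), (η * ((unramifiedTwist F (1 / 2) : QuasiChar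 F).toMonoidHom)), (η * ((unramifiedTwist F (1 / 2) : QuasiChar F).toMonoidHom))] : Fin 3 → (Fˣ →* ℂˣ)) a).comp (Matrix.GeneralLinearGroup.det.comp (Pi.evalMonoidHom (fun a : Fin 3 => GL {i : Fin 3 // (id : Fin 3 → Fin 3) i = a} F) a))) m : ℂˣ) : ℂ)) hX0
  have hJ := nontrivial_coinvariants_of_isConstituentOf_D'_high η hη h3cell
  refine { exists_pair_ne := ⟨⊥, ⊤, bot_ne_top_subrepresentation (Representation.parabolicIndGL F (![false, true, true] : Fin 3 → Bool) ((Representation.trivial ℂ (Π a : Bool, GL {i : Fin 3 // (![false, true, true] : Fin 3 → Bool) i = a} F) ℂ).twist (((η * ((unramifiedTwist F (1 / 2) : QuasiChar F).toMonoidHom)).comp (Matrix.GeneralLinearGroup.det.comp (Pi.evalMonoidHom (fun a : Bool => GL {i : Fin 3 // (![false, true, true] : Fin 3 → Bool) i = a} F) false))) * (η.comp (Matrix.GeneralLinearGroup.det.comp (Pi.evalMonoidHom (fun a : Bool => GL {i : Fin 3 // (![false, true, true] : Fin 3 → Bool) i = a} F) true))))))⟩, eq_bot_or_eq_top := fun N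 => ?_ }
  by_contra hN
  push Not at hN
  rcases exists_piece_X_two' η hη h3cell N hN.1 hN.2 with ⟨hfdN, hX2, h0⟩ | ⟨hfdQ, hX2, h0⟩
  · haveI := hfdN
    have hN0 : finrank ℂ ↥(⨅ m, Module.End.maxGenEigenspace (Representation.normalizedJacquetGL F (id : Fin 3 → Fin 3) N.toRepresentation m) (((∏ a : Fin 3, ((![(η * ((unramifiedTwist F (1 / 2) : QuasiChar F).toMonoidHom)⁻¹), (η * ((unramifiedTwist F (1 / 2) : QuasiChar F).toMonoidHom)), (η * ((unramifiedTwist F (1 / 2) : QuasiChar F).toMonoidHom))] : Fin 3 → (Fˣ →* ℂˣ)) a).comp (Matrix.GeneralLinearGroup.det.comp (Pi.evalMonoidHom (fun a : Fin 3 => GL {i : Fin 3 // (id : Fin 3 → Fin 3) i = a} F) a))) m : ℂˣ) : ℂ)) ≠ 0 := by omega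
    haveI := nontrivial_of_finrank_weightSpace_ne_zero N.toRepresentation (fun m : (Π a : Fin 3, GL {i : Fin 3 // (id : Fin 3 → Fin 3) i = a} F) => (((∏ a : Fin 3, ((![(η * ((unramifiedTwist F (1 / 2) : QuasiChar F).toMonoidHom)⁻¹), (η * ((unramifiedTwist F (1 / 2) : QuasiChar F).toMonoidHom)), (η * ((unramifiedTwist F (1 / 2) : QuasiChar F).toMonoidHom))] : Fin 3 → (Fˣ →* ℂˣ)) a).comp (Matrix.GeneralLinearGroup.det.comp (Pi.evalMonoidHom (fun a : Fin 3 => GL {i : Fin 3 // (id : Fin 3 → Fin 3) i = a} F) a))) m : ℂˣ) : ℂ)) hN0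
    have hω := exists_constituent_X_two η hη N.toRepresentation (hD.toRepresentation N) (fun r hr => hJ r (hr.of_subrepresentation N)) hX2 h0
    obtain ⟨r, -, hfdr, hrX, hr0⟩ := hω
    haveI := hfdr
    exact false_of_weights_X_two η hη hIRR r hrX hr0
  · haveI := hfdQ
    have hQ0 : finrank ℂ ↥(⨅ m, Module.End.maxGenEigenspace (Representation.normalizedJacquetGL F (id : Fin 3 → Fin 3) N.quotientRep m) (((∏ a : Fin 3, ((![(η * ((unramifiedTwist F (1 / 2) : QuasiChar F).toMonoidHom)⁻¹), (η * ((unramifiedTwist F (1 / 2) : QuasiChar F).toMonoidHom)), (η * ((unramifiedTwist F (1 / 2) : QuasiChar F).toMonoidHom))] : Fin 3 → (Fˣ →* ℂˣ)) a).comp (Matrix.GeneralLinearGroup.det.comp (Pi.evalMonoidHom (fun a : Fin 3 => GL {i : Fin 3 // (id : Fin 3 → Fin 3) i = a} F) a))) m : ℂˣ) : ℂ)) ≠ 0 := by omega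
    haveI := nontrivial_of_finrank_weightSpace_ne_zero N.quotientRep (fun m : (Π a : Fin 3, GL {i : Fin 3 // (id : Fin 3 → Fin 3) i = a} F) => (((∏ a : Fin 3, ((![(η * ((unramifiedTwist F (1 / 2) : QuasiChar F).toMonoidHom)⁻¹), (η * ((unramifiedTwist F (1 / 2) : QuasiChar F).toMonoidHom)), (η * ((unramifiedTwist F (1 / 2) : QuasiChar F).toMonoidHom))] : Fin 3 → (Fˣ →* ℂˣ)) a).comp (Matrix.GeneralLinearGroup.det.comp (Pi.evalMonoidHom (fun a : Fin 3 => GL {i : Fin 3 // (id : Fin 3 → Fin 3) i = a} F) a))) m : ℂˣ) : ℂ)) hQ0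
    have hω := exists_constituent_X_two η hη N.quotientRep (hD.quotientRep N) (fun r hr => hJ r (hr.of_quotientRep N)) hX2 h0
    obtain ⟨r, -, hfdr, hrX, hr0⟩ := hω
    haveI := hfdr
    exact false_of_weights_X_two η hη hIRR r hrX hr0

/-! ## §2 F5: `D_low(η) = D(η, ην½⁻¹)` is irreducible as soon as `D‴(η⁻¹)` is (IRR-T), hence as soon as `D″(η⁻¹)` is -/

/-- The letter identity `(ην½⁻¹)⁻¹ = η⁻¹ν½`. [folklore] -/
theorem inv_mul_nuHalf_inv : (η * ((unramifiedTwist F (1 / 2) : QuasiChar F).toMonoidHom)⁻¹)⁻¹ = η⁻¹ * ((unramifiedTwist F (1 / 2) : QuasiChar F).toMonoidHom) :=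
  MonoidHom.ext fun t => by
    simp only [MonoidHom.inv_apply, MonoidHom.mul_apply, mul_inv_rev, inv_inv]
    exact mul_comm _ _

omit [ValuativeRel F] [TopologicalSpace F] [IsNonarchimedeanLocalField F] in
/-- `χ⁻¹⁻¹ = χ` for characters (pointwise `inv_inv`, in the `⁻¹`-spelling of the ★ IRR-T statement). [folklore] -/
theorem inv_inv_hom (χ : Fˣ →* ℂˣ) : χ⁻¹⁻¹ = χ :=
  MonoidHom.ext fun t => by simp only [MonoidHom.inv_apply, inv_inv]

/-- **F5 — `D‴(η⁻¹) = D′(η⁻¹ν½, η⁻¹)` IRREDUCIBLE ⇒ `D_low(η) = D(η, ην½⁻¹) = Ind_{P₂₁}(η∘det₂ ⊠ ην½⁻¹)` IRREDUCIBLE**: ★ F1 IRR-T `isIrreducible_D'_iff` at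
`(x, y) = ((ην½⁻¹)⁻¹, η⁻¹)` reads `D′((ην½⁻¹)⁻¹, η⁻¹) irreducible ↔ D(η⁻¹⁻¹, (ην½⁻¹)⁻¹⁻¹) irreducible`; `inv_inv` and `inv_mul_nuHalf_inv`.
[cite: BernsteinZelevinsky1977, §2.3] [cite: Zelevinsky1980, §1.1, Prop. 2.10] -/
theorem isIrreducible_D_low_of (h : ((Representation.parabolicIndGL F (![false, true, true] : Fin 3 → Bool) ((Representation.trivial ℂ (Π a : Bool, GL {i : Fin 3 // (![false, true, true] : Fin 3 → Bool) i = a} F) ℂ).twist (((η⁻¹ * ((unramifiedTwist F (1 / 2) : QuasiChar F).toMonoidHom)).comp (Matrix.GeneralLinearGroup.det.comp (Pi.evalMonoidHom (fun a : Bool => GL {i : Fin 3 // (![false, true, true] : Fin 3 → Bool) i = a} F) false))) * (η⁻¹.comp (Matrix.GeneralLinearGroup.det.comp (Pi.evalMonoidHom (fun a : Bool => GL {i : Fin 3 // (![false, true, true] : Fin 3 → Bool) i = a} F) true))))))).IsIrreducible) : ((Representation.parabolicIndGL F (![false, false, true] : Fin 3 → Bool) ((Representation.trivial ℂ (Π a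 : Bool, GL {i : Fin 3 // (![false, false, true] : Fin 3 → Bool) i = a} F) ℂ).twist ((η.comp (Matrix.GeneralLinearGroup.det.comp (Pi.evalMonoidHom (fun a : Bool => GL {i : Fin 3 // (![false, false, true] : Fin 3 → Bool) i = a} F) false))) * ((η * ((unramifiedTwist F (1 / 2) : QuasiChar F).toMonoidHom)⁻¹).comp (Matrix.GeneralLinearGroup.det.comp (Pi.evalMonoidHom (fun a : Bool => GL {i : Fin 3 // (![false, false, true] : Fin 3 → Bool) i = a} F) true))))))).IsIrreducible := by
  have h' := isIrreducible_D'_iff (F := F) (η * ((unramifiedTwist F (1 / 2) : QuasiChar F).toMonoidHom)⁻¹)⁻¹ η⁻¹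
  rw [inv_inv_hom, inv_inv_hom, inv_mul_nuHalf_inv] at h'
  exact h'.1 h

/-- **F4′ + F5 — `D″(η⁻¹)` IRREDUCIBLE ⇒ `D_low(η)` IRREDUCIBLE** (under the cell binder `h3cell` for `I(Y)` in the `η⁻¹`-letters; `η⁻¹` has open kernel by ★ `ker_inv_eq_ker`).
So the C1′ brick IRR_low is a corollary of IRR″ (K2E3-p17). [cite: BernsteinZelevinsky1977, §2.3, Cor. 2.13, Thm. 2.9] [cite: Zelevinsky1980, §1.1, Ex. 3.2, Thm. 6.1] -/
theorem isIrreducible_D_low_of_isIrreducible_D_high (hη : IsOpen ((η.ker : Subgroup Fˣ) : Set Fˣ)) (hIRR : ((Representation.parabolicIndGL F (![false, false, true] : Fin 3 → Bool) ((Representation.trivial ℂ (Π a : Bool, GL {i : Fin 3 // (![false, false, true] : Fin 3 → Bool) i = a} F) ℂ).twist ((η⁻¹.comp (Matrix.GeneralLinearGroup.det.comp (Pi.evalMonoidHom (fun a : Bool => GL {i : Fin 3 // (![false, false, true] : Fin 3 → Bool) i = a} F) false))) * ((η⁻¹ * ((unramifiedTwist F (1 / 2) : QuasiChar F).toMonoidHom)).comp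 (Matrix.GeneralLinearGroup.det.comp (Pi.evalMonoidHom (fun a : Bool => GL {i : Fin 3 // (![false, false, true] : Fin 3 → Bool) i = a} F) true))))))).IsIrreducible)
    (h3cell : ∀ c : Fin 3 → Fin 2, Monotone c → Function.Surjective c →
      ∀ (W : Type) [AddCommGroup W] [Module ℂ W] (σ : Representation ℂ (Π a : Fin 2, GL {i : Fin 3 // c i = a} F) W),
        σ.IsIrreducible → σ.IsSmooth → σ.IsSupercuspidal →
        ∀ (N : Subrepresentation (jacquetGL F c (Representation.parabolicIndGL F (id : Fin 3 → Fin 3) ((Representation.trivial ℂ (Π a : Fin 3, GL {i : Fin 3 // (id : Fin 3 → Fin 3) i = a} F) ℂ).twist (∏ a : Fin 3, ((![(η⁻¹ * ((unramifiedTwist F (1 / 2) : QuasiChar F).toMonoidHom)), (η⁻¹ * ((unramifiedTwist F (1 / 2) : QuasiChar F).toMonoidHom)⁻¹), (η⁻¹ * ((unramifiedTwist F (1 / 2) : QuasiChar F).toMonoidHom))] : Fin 3 → (Fˣ →* ℂˣ)) a).comp (Matrix.GeneralLinearGroup.det.comp (Pi.evalMonoidHom (fun a : Fin 3 => GL {i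 : Fin 3 // (id : Fin 3 → Fin 3) i = a} F) a)))))))
          (q : N.toRepresentation.IntertwiningMap σ), q = 0) :
    ((Representation.parabolicIndGL F (![false, false, true] : Fin 3 → Bool) ((Representation.trivial ℂ (Π a : Bool, GL {i : Fin 3 // (![false, false, true] : Fin 3 → Bool) i = a} F) ℂ).twist ((η.comp (Matrix.GeneralLinearGroup.det.comp (Pi.evalMonoidHom (fun a : Bool => GL {i : Fin 3 // (![false, false, true] : Fin 3 → Bool) i = a} F) false))) * ((η * ((unramifiedTwist F (1 / 2) : QuasiChar F).toMonoidHom)⁻¹).comp (Matrix.GeneralLinearGroup.det.comp (Pi.evalMonoidHom (fun a : Bool => GL {i : Fin 3 // (![false, false, true] : Fin 3 → Bool) i = a} F) true))))))).IsIrreducible := by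
  have hηi : IsOpen ((η⁻¹.ker : Subgroup Fˣ) : Set Fˣ) := by rw [ker_inv_eq_ker]; exact hη
  exact isIrreducible_D_low_of η (isIrreducible_D'_high_of η⁻¹ hηi hIRR h3cell)

end Summit.HodgeConjecture.HodgeConjecture.Cruxes.H413.K2E3GL3OneLinkNestedHighIrreduciblePrime

end
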